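import Mathlib.NumberTheory.ArithmeticFunction.Defs
import Mathlib.NumberTheory.ArithmeticFunction.Misc
import Mathlib.Analysis.SpecialFunctions.Pow.Real
import Mathlib.Analysis.SpecialFunctions.Log.Basic
import Mathlib.Analysis.Complex.Basic
import Mathlib.Order.Filter.AtTopBot.Basic
import HarnessLib

/-!
# The Bourgain–Sarnak–Ziegler finite form of the Kátai (Daboussi) orthogonality criterion

Named fact (D-0014, sorry-free `def … : Prop`):

* `bourgainSarnakZiegler_criterion` — J. Bourgain, P. Sarnak, T. Ziegler, *Disjointness of
  Moebius from horocycle flows*, in: From Fourier Analysis and Number Theory to Radon Transforms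
  and Geometry, Dev. Math. 28 (2013), 67–83, **Theorem 2** (arXiv:1110.0992, (1.3)–(1.4)),
  AS PRINTED: let `F : ℕ → ℂ` with `|F| ≤ 1` and let `ν` be a multiplicative function with
  `|ν| ≤ 1`; let `τ > 0` be a small parameter and assume that for all primes
  `p₁ ≠ p₂ ≤ e^{1/τ}` one has, for `M` large enough, `|∑_{m ≤ M} F(p₁ m) conj (F(p₂ m))| ≤ τ M`.
  Then for `N` large enough `|∑_{n ≤ N} ν(n) F(n)| ≤ 2 √(τ log (1/τ)) · N`.

This is the quantitative ("finite") version of the bilinear criterion of Kátai (Acta Math. Hung.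
47 (1986)) after Daboussi; it is the standard tool for proving that a bounded sequence `F` is
orthogonal to EVERY bounded multiplicative function at once, by controlling only the bilinear
sums `∑ F(p₁ m) conj F(p₂ m)`. It is the printed input named by item
`AC0MultiplicativePretentious` (crux, "Kátai–BSZ step") of route
`Summit.PneNP.PneNP.Theses.Mobius`; not previously in the tree (searched `lean search`:
`Katai`, `Kátai`, `Daboussi`, `BourgainSarnakZiegler`, `criterion` in `NumberTheory/`).

## Conventions
* "multiplicative function" = Mathlib `ArithmeticFunction ℂ` with `IsMultiplicative`
  (`ν 1 = 1`, `ν (m n) = ν m ν n` for coprime `m, n`; the convention of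
  `Literature.NumberTheory.LFunctions.ElliottConjectureMRT`); the proof (BSZ §2, after (2.15))
  uses exactly coprime multiplicativity. `ν 0 = 0` is irrelevant: all sums start at `1`
  (`Finset.Icc 1 M`), as in the paper (`ℕ = {1, 2, …}` there).
* "`τ > 0` a small parameter": the proof (§2) takes an auxiliary `α` "small enough" depending on
  `τ`, i.e. the theorem is asserted for all sufficiently small `τ`; we render this literally as
  `∃ τ₀ > 0, ∀ τ ∈ (0, τ₀]`. For `τ ≥ 0.11` the conclusion is weaker than the trivial bound `N`
  anyway (`2√(τ log 1/τ) ≥ 1`).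
* "for `M` large enough" / "for `N` large enough" are `∀ᶠ … in atTop` on `ℕ`; the threshold in
  the hypothesis may depend on the pair `(p₁, p₂)` (finitely many pairs, so this is the same as a
  uniform threshold).
* `|z|` of a complex number is `‖z‖`.
-/

open Filter Finset
open scoped ComplexConjugate

namespace Literature.NumberTheory.Sieve

/-- **Bourgain–Sarnak–Ziegler 2013, Theorem 2** (finite Kátai–Daboussi criterion, as printed).
There is `τ₀ > 0` such that for every `0 < τ ≤ τ₀`, every `F : ℕ → ℂ` with `‖F n‖ ≤ 1` and
every multiplicative `ν : ℕ → ℂ` with `‖ν n‖ ≤ 1`: if for all primes `p₁ ≠ p₂` with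
`p₁, p₂ ≤ e^{1/τ}` one has `‖∑_{1 ≤ m ≤ M} F(p₁ m) · conj (F(p₂ m))‖ ≤ τ M` for all large `M`
((1.3)), then `‖∑_{1 ≤ n ≤ N} ν(n) F(n)‖ ≤ 2 √(τ log (1/τ)) · N` for all large `N` ((1.4)).
Printed input of the "Kátai–BSZ step" of item `AC0MultiplicativePretentious` of
`Summit.PneNP.PneNP.Theses.Mobius` (grounds that step; the item itself is not in print).
[cite: BourgainSarnakZiegler2013, Theorem 2] -/
def bourgainSarnakZiegler_criterion : Prop :=
  ∃ τ₀ : ℝ, 0 < τ₀ ∧ ∀ τ : ℝ, 0 < τ → τ ≤ τ₀ →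
    ∀ (F : ℕ → ℂ) (ν : ArithmeticFunction ℂ),
      (∀ n, ‖F n‖ ≤ 1) → ν.IsMultiplicative → (∀ n, ‖ν n‖ ≤ 1) →
      (∀ p₁ p₂ : ℕ, p₁.Prime → p₂.Prime → p₁ ≠ p₂ →
          (p₁ : ℝ) ≤ Real.exp (1 / τ) → (p₂ : ℝ) ≤ Real.exp (1 / τ) →
          ∀ᶠ M : ℕ in atTop,
            ‖∑ m ∈ Icc 1 M, F (p₁ * m) * conj (F (p₂ * m))‖ ≤ τ * M) →
      ∀ᶠ N : ℕ in atTop, ‖∑ n ∈ Icc 1 N, ν n * F n‖ ≤ 2 * Real.sqrt (τ * Real.log (1 / τ)) * N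

end Literature.NumberTheory.Sieve
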